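import Summits.ResolutionOfSingularities.KangarooAtlas.MizutaniExtremalIff
import Summits.ResolutionOfSingularities.KangarooAtlas.MizutaniExtremalForm
import Summits.ResolutionOfSingularities.KangarooAtlas.MizutaniRationalExponent
import HarnessLib

/-!
# Mizutani's Thm. 2.8 (second part) with Example 2.1, as an iff on Hironaka's objects `U(𝔭)`, `B_{P,𝔭}`

Cell `pub-rosobs`, Mizutani enclosure (seat mizutani-encloser-2, gen 8). AI-written; AI review is weaker than expert review;
NOT a resolution-of-singularities theorem (summit relevance C).

Mizutani (Nagoya Math. J. 52 (1973)), Example 2.1: the pair `(k·f, W)`, `f = Σ_{i<p} c₁^i (X_i + c₂ Z_i)` (`c₁, c₂` `p`-independent), «is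
an H-scheme of exponent `e(H) = 1` and `dim H = 2p − 1` … associated with a closed point in `ℙ^{2p−1}`»; Thm. 2.8: «if `dim H = 2p − 1` and
`H` is not a vector group with `V ∩ W = {0}`, then `H` is of the same type as Example 2.1».  With Hironaka's objects as in the tree
(`U(𝔭) = multAlgebra`, `U_+(𝔭)S = bIdeal`, `U(𝔭) ∩ L_e = hirForms`, `IsVectorGroup`, `exponent`; `Literature/…/HironakaGroupSchemeMultiplicity.lean`)
and the point-side reading of the type (the extremal scheme's point is `[c^{1/p}]`, `c` a `k^p`-basis of `k^p(y₀) ⊕ k^p(y₀)·y₁`), both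
statements together are ONE equivalence:

* **`extremal_iff_type_hironaka`** — for a homogeneous prime `𝔭 ⊂ k[X_0, …, X_n]`: (`𝔭` is a point of `ℙ^n_k`, no linear form lies in
  `U(𝔭)`, `B_{P,𝔭}` is not a vector group, `dim B_{P,𝔭} + 1 = 2p`) **iff** (`n + 1 = 2p` and `𝔭 = [c^{1/p}]` for a `k^p`-basis `c` of
  `k^p(y₀) ⊕ k^p(y₀)·y₁`, `(y₀, y₁)` a `p`-independent pair of `k`);
* `bIdeal_eq_span_addForm_of_type` — and then the exponent is `1`, `U(𝔭) ∩ L_1 = k·f` for one additive form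
  `f = Σ a_i X_i^p` whose coefficients are again a `k^p`-basis of some `k^p(y₀') ⊕ k^p(y₀')·y₁'`, `U(𝔭) = k[f]` and `B_{P,𝔭} = Spec S/(f)`
  (Example 2.1's hypersurface);
* **`mizutani1973_theorem28`** (appended) — THEOREM 2.8 AS PRINTED, BOTH PARTS, on Hironaka's objects: `B_{P,𝔭}` not a vector group ⇒
  `2p ≤ dim B_{P,𝔭} + 1`; and with no linear form in `U(𝔭)` and `dim B_{P,𝔭} + 1 = 2p` ⇒ the type of Example 2.1.

## References

* H. Mizutani, *Hironaka's additive group schemes*, Nagoya Math. J. 52 (1973) 85–95, Example 2.1, Thm. 2.8. [Mizutani1973HironakaGroupSchemes]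
-/

noncomputable section

open MvPolynomial Literature.AlgebraicGeometry.Resolution Literature.AlgebraicGeometry.Resolution.HironakaScheme
open Literature.RingTheory.MvPolynomial

namespace Summit.ResolutionOfSingularities.KangarooAtlas.Mizutani

universe u

section IffHironaka

variable (k : Type u) [Field k] (p : ℕ) [hp : Fact p.Prime] [CharP k p] {n : ℕ}
  (𝔭 : Ideal (MvPolynomial (Fin (n + 1)) k))

/-- **EXAMPLE 2.1 + THM. 2.8 (SECOND PART) AS ONE EQUIVALENCE ON HIRONAKA'S OBJECTS.**  For a homogeneous prime `𝔭` of `S = k[X_0, …, X_n]`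
(`char k = p`): `𝔭` is a point of `ℙ^n_k` with no linear form in `U(𝔭)` («`V ∩ W = {0}`»), `B_{P,𝔭} = Spec S/U_+(𝔭)S` not a vector group and
`dim B_{P,𝔭} + 1 = 2p` — IF AND ONLY IF — `n + 1 = 2p` and `𝔭 = [c_0^{1/p} : ⋯ : c_{2p−1}^{1/p}]` for a `k^p`-basis `(c_i)` of
`k^p(y₀) ⊕ k^p(y₀)·y₁ = span_{k^p}{y₀^m y₁^j : m < p, j ≤ 1}`, `(y₀, y₁)` a `p`-independent pair of `k` (the type of Example 2.1).
[cite: Mizutani1973HironakaGroupSchemes, Example 2.1 («e(H) = 1 and dim H = 2p − 1») and Thm. 2.8 (second part)] -/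
theorem extremal_iff_type_hironaka [𝔭.IsPrime] :
    (IsPoint k 𝔭 ∧ hirForms k p 𝔭 0 = ⊥ ∧ ¬ IsVectorGroup k 𝔭 ∧
      ringKrullDim (MvPolynomial (Fin (n + 1)) k ⧸ bIdeal k 𝔭) + 1 = (2 * p : WithBot ℕ∞)) ↔
    (n + 1 = 2 * p ∧ ∃ (c : Fin (n + 1) → k) (y : Fin 2 → k), LinearIndependent (frobPow k p 1) c ∧ PIndep p 1 y ∧
      𝔭 = ratPoint k p 1 c ∧ Submodule.span (frobPow k p 1) (Set.range c) =
        Submodule.span (frobPow k p 1) (Set.range fun mj : Fin p × Fin 2 => y 0 ^ (mj.1 : ℕ) * y 1 ^ (mj.2 : ℕ))) := by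
  rw [← extremal_iff_type k p 𝔭]
  constructor
  · rintro ⟨hP, hlin, hnv, hdim⟩
    have hexp := exponent_eq_one_of_not_isVectorGroup k p 𝔭 hP hnv hdim
    have h0 : invForms k p 𝔭 0 = ⊥ := by rw [← hirForms_eq_invForms 𝔭 0]; exact hlin
    have hV := invForms_one_ne_bot_of_exponent_eq_one k p 𝔭 hexp h0
    have hE1 : ExponentLE k p 𝔭 1 := ((exponent_eq_iff k p 𝔭).mp hexp).1
    rw [ringKrullDim_quotient_bIdeal_eq_hsDim_holds k p 𝔭 hP, ← hsDimAt_eq_hsDim k p 𝔭 hE1] at hdim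
    have h1 : hsDimAt k p 𝔭 1 + 1 = 2 * p := by exact_mod_cast hdim
    unfold hsDimAt at h1
    have hfin := finrank_invForms_le k p 𝔭 1
    exact ⟨hP, h0, hV, by omega⟩
  · rintro ⟨hP, h0, hV, hdim⟩
    have hlin : hirForms k p 𝔭 0 = ⊥ := by rw [hirForms_eq_invForms 𝔭 0]; exact h0
    obtain ⟨hn, hfr⟩ := card_eq_of_extremal k p 𝔭 hP h0 hV hdim
    -- the exponent is `1`: `ExponentLE 1` from `𝔭 = [c^{1/p}]`, not `0` since `(L_B)_0 = 0 ≠ (L_B)_1`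
    obtain ⟨-, c, y, -, -, heq, -, -⟩ := exists_pIndep_span_eq_of_extremal k p 𝔭 hP h0 hV hdim
    have hE1 : ExponentLE k p 𝔭 1 := by rw [heq]; exact exponentLE_ratPoint k p 1 c
    have hexp : exponent k p 𝔭 = 1 := by
      refine (exponent_eq_iff k p 𝔭).mpr ⟨hE1, fun e' he' hE' => ?_⟩
      have he0 : e' = 0 := by omega
      subst he0
      have h1 := hE' 1 (Nat.zero_le 1)
      rw [h0] at h1
      apply hV
      rw [h1, Submodule.span_eq_bot]
      rintro _ ⟨b, hb, rfl⟩
      have hb0 : b = 0 := hb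
      subst hb0
      funext i
      simp only [frobVec, Pi.zero_apply]
      exact zero_pow (pow_ne_zero _ hp.out.ne_zero)
    have hnv : ¬ IsVectorGroup k 𝔭 := fun h => by
      have := (isVectorGroup_iff_exponent_eq_zero_holds k p 𝔭 hP).mp h
      omega
    refine ⟨hP, hlin, hnv, ?_⟩
    rw [ringKrullDim_quotient_bIdeal_eq_hsDim_holds k p 𝔭 hP, ← hsDimAt_eq_hsDim k p 𝔭 hE1]
    unfold hsDimAt
    rw [hfr]
    have h2 : n + 1 - 1 + 1 = 2 * p := by omega
    exact_mod_cast h2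

/-- In the situation of `extremal_iff_type_hironaka`: the exponent of `B_{P,𝔭}` is `1`, `n + 1 = 2p`, and `U(𝔭) ∩ L_1 = k·f`, `U(𝔭) = k[f]`,
`U_+(𝔭)S = (f)` for ONE additive form `f = Σ_i a_i X_i^p` whose coefficient vector is again a `k^p`-basis of some `k^p(y₀') ⊕ k^p(y₀')·y₁'`
(`(y₀', y₁')` `p`-independent) — `B_{P,𝔭}` is Example 2.1's hypersurface. [cite: Mizutani1973HironakaGroupSchemes, Example 2.1 and Thm. 2.8 (second part)] -/
theorem bIdeal_eq_span_addForm_of_type [𝔭.IsPrime] (hP : IsPoint k 𝔭) (hlin : hirForms k p 𝔭 0 = ⊥) (hnv : ¬ IsVectorGroup k 𝔭)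
    (hdim : ringKrullDim (MvPolynomial (Fin (n + 1)) k ⧸ bIdeal k 𝔭) + 1 = (2 * p : WithBot ℕ∞)) :
    exponent k p 𝔭 = 1 ∧ n + 1 = 2 * p ∧ ∃ (a : Fin (n + 1) → k) (y : Fin 2 → k), a 0 = 1 ∧ LinearIndependent (frobPow k p 1) a ∧
      PIndep p 1 y ∧ hirForms k p 𝔭 1 = Submodule.span k {a} ∧ multAlgebra k 𝔭 = Algebra.adjoin k {addForm k p 1 a} ∧
      bIdeal k 𝔭 = Ideal.span {addForm k p 1 a} ∧
      Submodule.span (frobPow k p 1) (Set.range a) =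
        Submodule.span (frobPow k p 1) (Set.range fun mj : Fin p × Fin 2 => y 0 ^ (mj.1 : ℕ) * y 1 ^ (mj.2 : ℕ)) := by
  obtain ⟨hexp, hn, a, y, hy, ha, x', c', h', ha0, haind, hVa, hU, hB, -, hspan⟩ :=
    hirForms_one_eq_span_of_not_isVectorGroup k p 𝔭 hP hlin hnv hdim
  refine ⟨hexp, hn, a, fun i => (c' i : k), ha0, haind, pIndep_of_isRootTower h', hVa, hU, hB, ?_⟩
  set ρ := ((towerField 1 y).val.toLinearMap).restrictScalars (frobPow k p 1) with hρ
  have h := congrArg (Submodule.map ρ) hspan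
  rw [Submodule.map_span, Submodule.map_span, ← Set.range_comp, ← Set.range_comp] at h
  have h1 : (ρ ∘ fun i => (⟨a i, ha i⟩ : towerField 1 y)) = a := funext fun i => rfl
  have h2 : (ρ ∘ fun mj : Fin p × Fin 2 => c' 0 ^ (mj.1 : ℕ) * c' 1 ^ (mj.2 : ℕ)) =
      fun mj : Fin p × Fin 2 => (c' 0 : k) ^ (mj.1 : ℕ) * (c' 1 : k) ^ (mj.2 : ℕ) := by
    funext mj
    simp only [hρ, Function.comp_apply, LinearMap.restrictScalars_apply, AlgHom.toLinearMap_apply, map_mul, map_pow,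
      IntermediateField.coe_val]
  rw [h1, h2] at h
  exact h

end IffHironaka

/-! ## Appended (encloser-2 gen 8): Theorem 2.8 as printed, both parts, on Hironaka's objects -/

section Theorem28

variable (k : Type u) [Field k] (p : ℕ) [hp : Fact p.Prime] [CharP k p] {n : ℕ}
  (𝔭 : Ideal (MvPolynomial (Fin (n + 1)) k))

/-- **MIZUTANI 1973, THEOREM 2.8 (BOTH PARTS), AS PRINTED, ON HIRONAKA'S OBJECTS** («If `H` is not a vector group (i.e. `e(H) ≥ 1`), then
`dim H ≥ 2p − 1`.  Moreover if `dim H = 2p − 1` and `H` is not a vector group with `V ∩ W = {0}`, then `H` is of the same type as Example 2.1»),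
for the Hironaka scheme `H = B_{P,𝔭} = Spec S/U_+(𝔭)S` of a point `𝔭` of `ℙ^n_k`, `k` any field of characteristic `p`: if `B_{P,𝔭}` is not a
vector group then (1) `2p ≤ dim B_{P,𝔭} + 1`, and (2) if moreover no linear form lies in `U(𝔭)` and `dim B_{P,𝔭} + 1 = 2p`, then `n + 1 = 2p` and
`𝔭 = [c_0^{1/p} : ⋯ : c_{2p−1}^{1/p}]` for a `k^p`-basis `(c_i)` of `k^p(y₀) ⊕ k^p(y₀)·y₁`, `(y₀, y₁)` a `p`-independent pair — the type of
Example 2.1 (whose converse is `extremal_of_span_eq`, and whose form-side reading `U(𝔭) ∩ L_1 = k·f`, `B_{P,𝔭} = Spec S/(f)` is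
`bIdeal_eq_span_addForm_of_type`).  Part (1) is the case `e = 1` of the cell's `m(e) = 2p^e − 1` (`mizutani_lowerBound_hironaka'`).
[cite: Mizutani1973HironakaGroupSchemes, Thm. 2.8 (p. 90)] -/
theorem mizutani1973_theorem28 [𝔭.IsPrime] (hP : IsPoint k 𝔭) (hnv : ¬ IsVectorGroup k 𝔭) :
    (2 * p : WithBot ℕ∞) ≤ ringKrullDim (MvPolynomial (Fin (n + 1)) k ⧸ bIdeal k 𝔭) + 1 ∧
    (hirForms k p 𝔭 0 = ⊥ → ringKrullDim (MvPolynomial (Fin (n + 1)) k ⧸ bIdeal k 𝔭) + 1 = (2 * p : WithBot ℕ∞) →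
      n + 1 = 2 * p ∧ ∃ (c : Fin (n + 1) → k) (y : Fin 2 → k), LinearIndependent (frobPow k p 1) c ∧ PIndep p 1 y ∧
        𝔭 = ratPoint k p 1 c ∧ Submodule.span (frobPow k p 1) (Set.range c) =
          Submodule.span (frobPow k p 1) (Set.range fun mj : Fin p × Fin 2 => y 0 ^ (mj.1 : ℕ) * y 1 ^ (mj.2 : ℕ))) := by
  refine ⟨?_, fun hlin hdim => (extremal_iff_type_hironaka k p 𝔭).mp ⟨hP, hlin, hnv, hdim⟩⟩
  have hne : exponent k p 𝔭 ≠ 0 := fun h => hnv ((isVectorGroup_iff_exponent_eq_zero_holds k p 𝔭 hP).mpr h)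
  have h := mizutani_lowerBound_hironaka' k p 𝔭 hP (e := 1) (by omega)
  rwa [pow_one] at h

end Theorem28

end Summit.ResolutionOfSingularities.KangarooAtlas.Mizutani

end
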